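import Summits.BirchSwinnertonDyer.BirchSwinnertonDyer.Theorems.PrintX11aLowerHalfOfChildrenSharedNine
import Summits.BirchSwinnertonDyer.BirchSwinnertonDyer.Theorems.PrintX11aUpperNonSurjFiveOfNineFactsOddGS
import HarnessLib

/-!
# Route `PrintX11a` (cell bsd-print-x11a, D-0154 row 11): its THREE open cruxes and its registered leaf `WAllCornerX11a`
# from ONE list of inputs — the seven children of line «birth» r10 (crux L, item 19064) plus Wuthrich 2014 Prop. 21 —
# in the kernel, BY NAME (lead bsd-line-x11a-p1 gen 3; `--supports stmt-BirchSwinnertonDyer-19064` helper)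

HONEST FRAMING.  Two composition theorems; no definition, no named fact minted, no `sorry`.  Both are CONDITIONAL and close
NOTHING: the gate records a `conditional-result`; the leaf `Summit.BirchSwinnertonDyer.WAllCornerX11a` (rung W-ALL ∕ 11, tagged
`@[conjecture]`) is NOT proved — it is DISPLAYED modulo every hypothesis below; BSD is proved for no curve and no class; PARTITION 0.
beyond-print theorem: no.  What the file adds is bookkeeping in the kernel: the cell referee's reading «leaf X11a ≡ {item 19948,
Greenberg Conj. 1.11 ω⁰ on the deep surjective X11a pairs at p ≥ 5, the très-ramifié open core at 3} + named published facts» as ONE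
theorem whose hypotheses are EXACTLY those inputs, each a registered stub text or a named Literature fact, consumed by name.

## The inputs (hypotheses), all displayed

* `h9`  — crux U3's registered stub `FineMu.stub_nineFactsOddGS` (finemu3 r6, item 20613; = finemu5 r7's, item 20614; = birth r10's
  `stub_nineFactsOddGS`, item 19064): nine print-exact named facts (Stein–Wuthrich 6.1 ×2, Greenberg–Stevens at odd primes, Kato 12.4,
  modularity, Kato §17.13 V′∕VI′∕XI′ `_contra`, Mazur 4.1).
* `h11` — birth r10's `stub_elevenFactsLower`: eleven print-exact named facts (EPW 3.1.1 ∕ Thm 1 alg ∕ 5.1.3 at an odd prime, X. Wan 2015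
  Thm 4 (irred), Deligne–Serre 6.1, Hida 3.26, Kato–Wuthrich A32, Gross–Zagier–Kolyvagin, BDMTV Thm 1.2, Ribet–DDT additive drop at 3,
  Carayol–Livné).
* `hR`  — birth r10's `stub_suRamFactLower`: Skinner–Urban 2014 Thm 3.6.4 RATIONAL at a weight-`k` member WITH (ram) [cell flag
  SU14-12.3.6@3 — consumed only on the Kodaira sub-locus at 3].
* `hQ`  — birth r10's `stub_partnerFactsLower`: five print-exact facts of the weight-two partner road at 3 (EPW Cor 5.1.4, Thm 1 ×2 at an
  odd prime [token EPW06@3]; Yan–Zhu 2026 Thm 4.9 rational [token YZ26@3]; the period unit at 3).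
* `h48` — K2's OPEN item 19948 `Theses.ErratumRoadFive.NonSurjCornerTwinMuAn` (Greenberg's analytic μ = 0 at the non-surjective X11a
  pairs, `p ∈ {5,7}`) = birth's `stub_twinMuAn`.
* `hS`  — birth's `stub_muAnSurjDeepFive`: Greenberg's analytic μ = 0 (ω⁰ branch) at the deep SURJECTIVE X11a pairs, `p ≥ 5` — OPEN
  (LNM 1716 Conj. 1.11 on that locus; no printed source: no Hida member on X11a has a (ram) prime).
* `hT`  — birth's `stub_lowerTresRamifieThree`: the lower half on the très-ramifié off-Kodaira deep X11a pairs at 3 — THE OPEN CORE.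
* `hWu` — Wuthrich 2014 Prop. 21 (`Wuthrich2014.sha_dvd_analyticSha`) = the route's support item `WuthrichShaDividesAnalyticSha`
  (stmt-BirchSwinnertonDyer-19285): the Euler-system (upper) half on SURJECTIVE pairs, in print.  (The route's other two `PrintInputsX11a`
  conjuncts, Gross–Zagier–Kolyvagin and modularity, are already conjuncts of `h11` and `h9`.)

## The theorems

* `cruxes_of_children_r10 : h9 → h11 → hR → hQ → h48 → hS → hT → X11aLowerHalf ∧ UpperNonSurjThree ∧ UpperNonSurjFive ∧ X11aNonSurjEulerHalf`
  — the route's three open cruxes (items 19064, 20613, 20614) and the parent 20406 BY NAME: L by `Birth.x11aLowerHalf_of_children_r10`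
  (p635707), U3 by x11a-p2 g4's `upperNonSurjThree_of_nineFacts_oddGS_glue` (p625569) from `h9` ALONE, U5 and the parent by x11a-p3 g7's
  `upperNonSurjFive_of_nonSurjCornerTwinMuAn_of_nineFactsOddGS_glue₃` ∕ `x11aNonSurjEulerHalf_of_nonSurjCornerTwinMuAn_of_nineFactsOddGS`
  (p630615) from `h48`, BDMTV (conjunct 9 of `h11`) and `h9`.
* `wAllCornerX11a_of_children_r10 : h9 → … → hT → hWu → Summit.BirchSwinnertonDyer.WAllCornerX11a` — the route's own deciding theorem
  `Theses.PrintX11a.closes` (planner, 2026-08-27) applied to the two halves above and `⟨hWu, GZK, modularity⟩`.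

So, in the kernel: the class theorem of leaf X11a holds MODULO twenty-seven named published facts (one print-gap-flagged at 3, two with
@3 disclosure tokens), K2's item 19948, and two OPEN statements (Greenberg Conj. 1.11 ω⁰ on the deep surjective X11a pairs at p ≥ 5;
the très-ramifié core at 3).  Nothing more is claimed.

References: [Miller2011LMS] Def. 1.1; [Wuthrich2014] Prop. 21, Lemma 20; [Kato2004Asterisque] Thm. 12.4, §17.13; [SteinWuthrich2013]
Thm. 6.1; [GreenbergLNM1716] Conj. 1.11; [BalakrishnanEtAl2019] Thm. 1.2; [EmertonPollackWeston2006] Thm. 1, Cor. 5.1.4;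
[SkinnerUrban2014] Thm. 3.6.4; [Wan2015] Thm. 4; cell files `Cruxes/X11aLowerHalf/Lines/birth.lean` (r10), `Cruxes/UpperNonSurjThree/Lines/finemu3.lean`
(r6), `Cruxes/UpperNonSurjFive/Lines/finemu5.lean` (r7), `Cruxes/X11aLowerHalf/LEAD-g3-VERDICT.md`.
-/

set_option autoImplicit false
set_option linter.dupNamespace false -- the directory name repeats the summit name (sibling precedent)

noncomputable section

open scoped Classical

open WeierstrassCurve IsDedekindDomain Rat.HeightOneSpectrum
  Literature.NumberTheory.EllipticCurves
  Literature.NumberTheory.EllipticCurves.ModularForms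
  Literature.NumberTheory.EllipticCurves.Rank1Residual
  Literature.NumberTheory.EllipticCurves.Rank1Residual.Typed
  Literature.NumberTheory.EllipticCurves.Wuthrich2014
  Literature.NumberTheory.EllipticCurves.SteinWuthrich2013
  Literature.NumberTheory.EllipticCurves.Greenberg1999
  Literature.NumberTheory.EllipticCurves.Kato2004
  Literature.NumberTheory.EllipticCurves.GreenbergVatsal2000
  Literature.NumberTheory.EllipticCurves.EmertonPollackWeston2006
  Literature.NumberTheory.EllipticCurves.SkinnerUrban2014
  Literature.NumberTheory.EllipticCurves.BalakrishnanEtAl2019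
  Summit.BirchSwinnertonDyer.Rank1Residual

namespace Summit.BirchSwinnertonDyer.BirchSwinnertonDyer.Theorems.PrintX11aLeaf

/-- **Route `PrintX11a`'s three open cruxes — L (19064), U3 (20613), U5 (20614) — and the parent 20406, BY NAME, from the seven
registered stub texts of line «birth» r10** (CONDITIONAL; closes nothing; BSD is proved for no curve).  `h9` = crux U3's nine-fact stub
text (shared with U5 and L), `h11` = L's eleven other facts (BDMTV is its ninth conjunct, Gross–Zagier–Kolyvagin its eighth), `hR` = the
Skinner–Urban (ram) fact [flag SU14-12.3.6@3], `hQ` = the five partner facts, `h48` = item 19948, `hS` = Greenberg's analytic μ = 0 on the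
deep surjective X11a pairs at `p ≥ 5` (OPEN), `hT` = the très-ramifié open core at 3 (OPEN).
[cite: GreenbergLNM1716, §1 Conj. 1.11 (p. 61)] [cite: Kato2004Asterisque, Thm. 12.4 (p. 221), §17.13 (pp. 279–280)]
[cite: SteinWuthrich2013, Thm. 6.1 (p. 20)] [cite: BalakrishnanEtAl2019, §1 Thm. 1.2] [cite: Miller2011LMS, Def. 1.1 (arXiv:1010.2431 p. 3)] -/
theorem cruxes_of_children_r10
    (h9 : thm61_splitMultiplicative ∧ thm61_nonsplitMultiplicative ∧
      (∀ (W : WeierstrassCurve ℚ) [W.IsElliptic] [W.IsGloballyMinimal] (p : ℕ) [Fact p.Prime],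
        p ≠ 2 → greenberg_stevens (W := W) (p := p)) ∧
      Kato2004.thm12_4 ∧ exists_isNewformOf ∧
      Kato2004.exists_multDivisibilityInputs_nonsplit_contra ∧
      Kato2004.exists_multDivisibilityInputs_split_contra ∧
      Kato2004.exists_multDivisibilityInputs_fine_contra ∧ mazur_not_dvd_maninConstant_of_odd)
    (h11 : thm311_cotorsion_weightK_member_ofLevel_odd ∧ thm1_muAlg_of_weightK_member_ofLevel_odd ∧
      Wan2015.thm4_rational_weightK_member_of_bdd_ofLevel_irred ∧
      thm513_transfer_from_weightK_member_of_bdd_ofLevel_odd ∧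
      DeligneSerre1974.thm61_exists_adicGaloisRep ∧ Hida2000_thm326_ordinary ∧
      kato_charIdeal_dvd_multiplicative_of_surjective ∧
      rank_eq_analyticRank_of_analyticRank_le_one ∧
      thm12_not_le_normalizer_splitCartan ∧
      ribet1990_levelLowering_gamma0_newform_at_three_additiveDrop ∧
      carayolLivne_additivePrime_dvd_level_of_congruent_newform)
    (hR : thm364_rational_weightK_member_of_bdd_ofLevel_ram)
    (hQ : cor514_transfer_of_goodOrdinary_odd ∧ YanZhu2026.thm49_charIdeal_eq_padicLFunction ∧
      realPeriodRat_eq_unit_mul_plusPeriod_three ∧ thm1_muAlg_transfer_goodOrdinary_of_mult_odd ∧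
      thm1_muAn_transfer_goodOrdinary_of_mult_odd)
    (h48 : Summit.BirchSwinnertonDyer.BirchSwinnertonDyer.Theses.ErratumRoadFive.NonSurjCornerTwinMuAn)
    (hS : ∀ (W : WeierstrassCurve ℚ) [W.IsElliptic] [W.IsGloballyMinimal] (p : ℕ) [Fact p.Prime],
      ClassX11a W p → 5 ≤ p → Surj W p → ¬ X11a.ShaAnUnit W p → X11a.MuAnZeroAt W p)
    (hT : ∀ (W : WeierstrassCurve ℚ) [W.IsElliptic] [W.IsGloballyMinimal] (p : ℕ) [Fact p.Prime],
      ClassX11a W p → p = 3 → ¬ X11a.ShaAnUnit W p →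
      ¬ (Surj W p ∧ ∃ v : HeightOneSpectrum ℤ, W.HasAdditiveReductionAt v ∧
          3 ∣ (W.kodairaSymbolAt v).componentGroupOrder ∧ ¬ natGenerator v ^ 3 ∣ W.conductorNorm ℤ) →
      ¬ p ∣ padicValInt p W.minimalDiscriminantInt → MissingLowerBoundAt W p) :
    Summit.BirchSwinnertonDyer.BirchSwinnertonDyer.Theses.PrintX11a.X11aLowerHalf ∧
      Summit.BirchSwinnertonDyer.BirchSwinnertonDyer.Theses.PrintX11a.UpperNonSurjThree ∧
      Summit.BirchSwinnertonDyer.BirchSwinnertonDyer.Theses.PrintX11a.UpperNonSurjFive ∧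
      Summit.BirchSwinnertonDyer.BirchSwinnertonDyer.Theses.PrintX11a.X11aNonSurjEulerHalf := by
  obtain ⟨hJs, hJn, hGS, h12, hnf, hns', hsp', hfine', hMz⟩ := h9
  have hB : thm12_not_le_normalizer_splitCartan := h11.2.2.2.2.2.2.2.2.1
  exact ⟨Birth.x11aLowerHalf_of_children_r10 ⟨hJs, hJn, hGS, h12, hnf, hns', hsp', hfine', hMz⟩ h11 hR hQ h48 hS hT,
    upperNonSurjThree_of_nineFacts_oddGS_glue ⟨hJs, hJn, hGS, h12, hnf, hns', hsp', hfine', hMz⟩,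
    upperNonSurjFive_of_nonSurjCornerTwinMuAn_of_nineFactsOddGS_glue₃ h48 hB ⟨hJs, hJn, hGS, h12, hnf, hns', hsp', hfine', hMz⟩,
    x11aNonSurjEulerHalf_of_nonSurjCornerTwinMuAn_of_nineFactsOddGS hB h48 hJs hJn hGS h12 hnf hns' hsp' hfine' hMz⟩

/-- **The registered leaf `WAllCornerX11a` (rung W-ALL ∕ 11: non-CM, `ClassX11a W p` ⇒ `BSD(E,p)`) DISPLAYED modulo the seven children
of line «birth» r10 and Wuthrich 2014 Prop. 21** — the route's deciding theorem `Theses.PrintX11a.closes` applied to the two halves of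
`cruxes_of_children_r10` and to `PrintInputsX11a = ⟨Prop. 21, Gross–Zagier–Kolyvagin, modularity⟩` (the last two are conjuncts of `h11` ∕ `h9`).
CONDITIONAL: the conclusion is an OPEN `@[conjecture]` leaf and is NOT proved here — it holds MODULO twenty-seven named published facts,
K2's item 19948 and two OPEN statements (`hS`, `hT`); the gate records a `conditional-result`; PARTITION 0; BSD is proved for no class.
[cite: Miller2011LMS, Def. 1.1 (arXiv:1010.2431 p. 3)] [cite: Wuthrich2014, Prop. 21 (p. 400)] [cite: GreenbergLNM1716, §1 Conj. 1.11 (p. 61)]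
[cite: Kato2004Asterisque, Thm. 12.4 (p. 221)] [cite: SkinnerUrban2014, Thm. 3.6.4 (p. 43)] -/
theorem wAllCornerX11a_of_children_r10
    (h9 : thm61_splitMultiplicative ∧ thm61_nonsplitMultiplicative ∧
      (∀ (W : WeierstrassCurve ℚ) [W.IsElliptic] [W.IsGloballyMinimal] (p : ℕ) [Fact p.Prime],
        p ≠ 2 → greenberg_stevens (W := W) (p := p)) ∧
      Kato2004.thm12_4 ∧ exists_isNewformOf ∧
      Kato2004.exists_multDivisibilityInputs_nonsplit_contra ∧
      Kato2004.exists_multDivisibilityInputs_split_contra ∧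
      Kato2004.exists_multDivisibilityInputs_fine_contra ∧ mazur_not_dvd_maninConstant_of_odd)
    (h11 : thm311_cotorsion_weightK_member_ofLevel_odd ∧ thm1_muAlg_of_weightK_member_ofLevel_odd ∧
      Wan2015.thm4_rational_weightK_member_of_bdd_ofLevel_irred ∧
      thm513_transfer_from_weightK_member_of_bdd_ofLevel_odd ∧
      DeligneSerre1974.thm61_exists_adicGaloisRep ∧ Hida2000_thm326_ordinary ∧
      kato_charIdeal_dvd_multiplicative_of_surjective ∧
      rank_eq_analyticRank_of_analyticRank_le_one ∧
      thm12_not_le_normalizer_splitCartan ∧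
      ribet1990_levelLowering_gamma0_newform_at_three_additiveDrop ∧
      carayolLivne_additivePrime_dvd_level_of_congruent_newform)
    (hR : thm364_rational_weightK_member_of_bdd_ofLevel_ram)
    (hQ : cor514_transfer_of_goodOrdinary_odd ∧ YanZhu2026.thm49_charIdeal_eq_padicLFunction ∧
      realPeriodRat_eq_unit_mul_plusPeriod_three ∧ thm1_muAlg_transfer_goodOrdinary_of_mult_odd ∧
      thm1_muAn_transfer_goodOrdinary_of_mult_odd)
    (h48 : Summit.BirchSwinnertonDyer.BirchSwinnertonDyer.Theses.ErratumRoadFive.NonSurjCornerTwinMuAn)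
    (hS : ∀ (W : WeierstrassCurve ℚ) [W.IsElliptic] [W.IsGloballyMinimal] (p : ℕ) [Fact p.Prime],
      ClassX11a W p → 5 ≤ p → Surj W p → ¬ X11a.ShaAnUnit W p → X11a.MuAnZeroAt W p)
    (hT : ∀ (W : WeierstrassCurve ℚ) [W.IsElliptic] [W.IsGloballyMinimal] (p : ℕ) [Fact p.Prime],
      ClassX11a W p → p = 3 → ¬ X11a.ShaAnUnit W p →
      ¬ (Surj W p ∧ ∃ v : HeightOneSpectrum ℤ, W.HasAdditiveReductionAt v ∧
          3 ∣ (W.kodairaSymbolAt v).componentGroupOrder ∧ ¬ natGenerator v ^ 3 ∣ W.conductorNorm ℤ) →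
      ¬ p ∣ padicValInt p W.minimalDiscriminantInt → MissingLowerBoundAt W p)
    (hWu : Wuthrich2014.sha_dvd_analyticSha) :
    Summit.BirchSwinnertonDyer.WAllCornerX11a := by
  obtain ⟨hL, -, -, hE⟩ := cruxes_of_children_r10 h9 h11 hR hQ h48 hS hT
  exact Summit.BirchSwinnertonDyer.BirchSwinnertonDyer.Theses.PrintX11a.closes hL hE ⟨hWu, h11.2.2.2.2.2.2.2.1, h9.2.2.2.2.1⟩

end Summit.BirchSwinnertonDyer.BirchSwinnertonDyer.Theorems.PrintX11aLeaf

end
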